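import Literature.NumberTheory.EllipticCurves.Kato2004.IntegralH1FiniteProofs
import HarnessLib

/-!
# A finitely generated, `p`-saturated `ℤ_p`-submodule of `H¹(Γ_ℚ, T_pW)` containing `H¹(ℤ[1/p], T_pW)`,
# and the `p`-saturated hull of `H¹(ℤ[1/p], T_pW)` (finitely generated, of bounded exponent over it)

Topic `NumberTheory/EllipticCurves`, sub-directory `Kato2004` (namespace = path).  THEOREMS ONLY (no definition, no
named fact, no `sorry`).  The proof of the tree theorem `Kato2004.module_finite_integralH1_top`
(`IntegralH1FiniteProofs`, cell `bsd-potss`: Kato §8.2 / Lemma 8.5, AEC VII.4.1 + X.4.3, Nakayama over `ℤ_p`)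
constructs — as a local `let` — the auxiliary submodule `J ⊇ integralH1` of classes vanishing on the inertia
above the GOOD places `v ∤ p`, proves it is finitely generated over `ℤ_p` and CLOSED UNDER DIVISION BY `p` in
`H¹(Γ_ℚ, T_pW)` (the inertia of a good `v ∤ p` acts trivially on `T_pW`, so `H¹(I_𝔓, T_pW)` has no
`p`-torsion).  This file re-exposes that construction as a theorem
(`exists_saturated_finite_submodule_ge_integralH1`, the proof copied VERBATIM) and derives the
`p`-SATURATED HULL of `H¹(ℤ[1/p], T_pW)` inside `H¹(Γ_ℚ, T_pW)`: the classes with a `p`-power multiple in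
`integralH1` form a finitely generated `ℤ_p`-submodule `N ⊇ integralH1`, closed under division by `p`, with
`p^b N ⊆ integralH1` for one `b` (`exists_saturatedHull_integralH1`).  `integralH1` itself need NOT be
`p`-saturated (bad places `v ≠ p`: `H¹(I_𝔓, T_pW)` may have torsion), which is why the hull is the right
domain for index counts «`[N : p^e N] = p^{e · rank}`».  Brick of the INPUTS desk's road for the stub
`stub_rankIntegralH1LeSelmerCorankAtDoor` of crux stmt-BirchSwinnertonDyer-23752 (compact-versus-discrete
Selmer rank dictionary, `≤` half).

References: K. Kato, Astérisque 295 (2004), §8.2 / Lemma 8.5 (pp. 180–184), §13.8 (p. 228) [Kato2004Asterisque];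
J. H. Silverman, *AEC* (2009) VII.4.1, X.4.3 [SilvermanAEC2009].
-/

noncomputable section

open scoped Classical NumberField
open CategoryTheory Field IsDedekindDomain NumberField
open Literature.NumberTheory.GaloisRepresentations
open Literature.NumberTheory.EllipticCurves Literature.NumberTheory.EllipticCurves.Kato2004
open Literature.NumberTheory.EllipticCurves.Kato2004.EulerSystemValues
open WeierstrassCurve (geomPoints geomTorsion galH1Torsion torsionPoints torsionGaloisModule)

namespace Literature.NumberTheory.EllipticCurves.Kato2004

open IntegralH1Finite

variable (W : WeierstrassCurve ℚ) [W.IsElliptic] (p : ℕ) [Fact p.Prime]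
  [ContinuousSMul ℤ_[p] (W.tateModule p)]

/-- **A finitely generated `p`-saturated submodule `J ⊇ H¹(ℤ[1/p], T_pW)` of `H¹(Γ_ℚ, T_pW)`**: the classes
vanishing on the inertia subgroups above the places `v ∤ p` of GOOD reduction (the `J` of the proof of
`Kato2004.module_finite_integralH1_top`, verbatim): `integralH1 ≤ J`, `J` is finitely generated over `ℤ_p`
(reduction modulo `p` into the finite `H¹(Γ_ℚ, W[p]; S ∪ {p})` + kernel `= p·J` + separatedness + Nakayama), and
`p • z ∈ J ⇒ z ∈ J` (the inertia of a good `v ∤ p` acts trivially on `T_pW`).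
[cite: Kato2004Asterisque, §8.2 Lemma 8.5 (pp. 180–184) and §12.2 (12.2.1) (p. 220)] [cite: SilvermanAEC2009, Prop. VII.4.1(b) and Lemma X.4.3] -/
theorem exists_saturated_finite_submodule_ge_integralH1 :
    ∃ J : Submodule ℤ_[p] (H1 (tateRep W p) ⊤), integralH1 (tateRep W p) p ⊤ ≤ J ∧ Module.Finite ℤ_[p] ↥J ∧
      ∀ z : H1 (tateRep W p) ⊤, (p : ℤ_[p]) • z ∈ J → z ∈ J := by
  classical
  have hp : p.Prime := Fact.out
  -- the finitely many bad places
  obtain ⟨S, hS⟩ : ∃ S : Finset (HeightOneSpectrum (𝓞 ℚ)), ∀ v, v ∉ S → W.HasGoodReductionAt v := by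
    have h := WeierstrassCurve.eventually_hasGoodReductionAt W
    rw [Filter.eventually_cofinite] at h
    exact ⟨h.toFinset, fun v hv => by_contra fun hbad => hv (h.mem_toFinset.mpr hbad)⟩
  -- places `v ≠ primePlace p` have residue characteristic `≠ p`
  have hne : ∀ v : HeightOneSpectrum (𝓞 ℚ), v ≠ primePlace p →
      ((Rat.HeightOneSpectrum.primesEquiv v : Nat.Primes) : ℕ) ≠ p := by
    intro v hv h
    apply hv
    apply (Rat.HeightOneSpectrum.primesEquiv (R := 𝓞 ℚ)).injective
    rw [primesEquiv_primePlace]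
    exact Subtype.ext h
  -- the auxiliary submodule `J ⊇ integralH1`: vanishing on the inertia above the GOOD `v ∤ p`
  let J : Submodule ℤ_[p] (H1 (tateRep W p) ⊤) :=
    { carrier := {x | ∀ v : HeightOneSpectrum (𝓞 ℚ),
        ((Rat.HeightOneSpectrum.primesEquiv v : Nat.Primes) : ℕ) ≠ p → W.HasGoodReductionAt v →
        ∀ 𝔓 ∈ v.primesAbove,
          resLe (tateRep W p).toTopRep
            (inf_le_left : (⊤ : Subgroup (absoluteGaloisGroup ℚ)) ⊓
              𝔓.inertia (absoluteGaloisGroup ℚ) ≤ ⊤) 1 x = 0}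
      zero_mem' := fun _ _ _ _ _ ↦ map_zero _
      add_mem' := by
        intro x y hx hy v hv hgood 𝔓 h𝔓
        rw [map_add, hx v hv hgood 𝔓 h𝔓, hy v hv hgood 𝔓 h𝔓, add_zero]
      smul_mem' := by
        intro a x hx v hv hgood 𝔓 h𝔓
        rw [map_smul, hx v hv hgood 𝔓 h𝔓, smul_zero] }
  have hJ : ∀ x : H1 (tateRep W p) ⊤, x ∈ J ↔ ∀ v : HeightOneSpectrum (𝓞 ℚ),
      ((Rat.HeightOneSpectrum.primesEquiv v : Nat.Primes) : ℕ) ≠ p → W.HasGoodReductionAt v →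
        ∀ 𝔓 ∈ v.primesAbove,
          resLe (tateRep W p).toTopRep
            (inf_le_left : (⊤ : Subgroup (absoluteGaloisGroup ℚ)) ⊓
              𝔓.inertia (absoluteGaloisGroup ℚ) ≤ ⊤) 1 x = 0 := fun x ↦ Iff.rfl
  have hle : integralH1 (tateRep W p) p ⊤ ≤ J := fun x hx ↦
    (hJ x).mpr fun v hv _ 𝔓 h𝔓 ↦ (mem_integralH1_iff _ p ⊤ x).mp hx v hv 𝔓 h𝔓
  -- `J` is closed under division by `p`
  have hdiv : ∀ z : H1 (tateRep W p) ⊤, (p : ℤ_[p]) • z ∈ J → z ∈ J := by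
    intro z hz
    refine (hJ z).mpr fun v hv hgood 𝔓 h𝔓 ↦ ?_
    refine eq_zero_of_prime_smul_eq_zero_of_forall_smul_eq W p _
      (forall_smul_eq_of_hasGoodReductionAt W p hgood hv h𝔓) _ ?_
    rw [← map_smul]
    exact (hJ _).mp hz v hv hgood 𝔓 h𝔓
  -- the finite target `H¹(Γ_ℚ, W[p]; S ∪ {p})`
  set S' : Set (HeightOneSpectrum (𝓞 ℚ)) := (↑S : Set (HeightOneSpectrum (𝓞 ℚ))) ∪ {primePlace p}
    with hS'
  have hS'fin : S'.Finite := (S.finite_toSet).union (Set.finite_singleton _)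
  haveI : ContinuousSMul (absoluteGaloisGroup ℚ) (geomTorsion W (p : ℤ)) :=
    W.continuousSMul_geomTorsion (WeierstrassCurve.isOpen_stabilizer_point_holds W) (p : ℤ)
  haveI : Finite (geomTorsion W (p : ℤ)) :=
    W.finite_torsionPoints_holds (AlgebraicClosure ℚ) (by exact_mod_cast hp.ne_zero)
  haveI hfinF : Finite (h1Unramified (geomTorsion W (p : ℤ)) S') :=
    finite_h1Unramified_holds ℚ (geomTorsion W (p : ℤ)) hS'fin
  -- the reduction map on `J`
  let r : J →+ discreteH1 (absoluteGaloisGroup ℚ) (geomTorsion W (p : ℤ)) :=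
    { toFun := fun x ↦ (ofTopSubgroup (W.torsionGaloisModule (p : ℤ)).toTopRep 1).hom
        (reduceH1 W p ⊤ (x : H1 (tateRep W p) ⊤))
      map_zero' := by simp only [ZeroMemClass.coe_zero, map_zero]; rfl
      map_add' := fun x y ↦ by simp only [Submodule.coe_add, map_add]; rfl }
  have hr_apply : ∀ x : J, r x = (ofTopSubgroup (W.torsionGaloisModule (p : ℤ)).toTopRep 1).hom
      (reduceH1 W p ⊤ (x : H1 (tateRep W p) ⊤)) := fun x ↦ rfl
  -- (1) `r` lands in the finite group
  have hr : ∀ x : J, r x ∈ h1Unramified (geomTorsion W (p : ℤ)) S' := by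
    intro x
    rw [mem_h1Unramified_iff]
    intro v hvS 𝔓 h𝔓
    have hvS1 : v ∉ S := fun h ↦ hvS (Set.mem_union_left _ h)
    have hvp : v ≠ primePlace p := fun h ↦ hvS (Set.mem_union_right _ (by simp [h]))
    rw [hr_apply]
    refine ofTopSubgroup_mem_unramifiedKer_of_resLe_eq_zero W (p : ℤ) _ 𝔓 ?_
    rw [← reduceH1_resLe, (hJ _).mp x.2 v (hne v hvp) (hS v hvS1) 𝔓 h𝔓, map_zero]
  -- (2) the kernel of `r` consists of `p`-multiples (in `J`)
  have hker : ∀ x : J, r x = 0 → ∃ y : J, (p : ℤ_[p]) • y = x := by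
    intro x hx
    rw [hr_apply] at hx
    have h0 : reduceH1 W p ⊤ (x : H1 (tateRep W p) ⊤) = 0 :=
      eq_zero_of_ofTopSubgroup_eq_zero _ _ hx
    obtain ⟨z, hz⟩ := exists_smul_eq_of_reduceH1_eq_zero W p ⊤ _ h0
    have hzJ : z ∈ J := hdiv z (by rw [hz]; exact x.2)
    exact ⟨⟨z, hzJ⟩, Subtype.ext hz⟩
  -- (3) `J` is `p`-adically separated
  have hsep : ∀ x : J, (∀ k : ℕ, ∃ y : J, ((p : ℤ_[p]) ^ k) • y = x) → x = 0 := by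
    intro x hx
    refine Subtype.ext (eq_zero_of_forall_mem_pow_smul W p ⊤ (x : H1 (tateRep W p) ⊤) fun k ↦ ?_)
    obtain ⟨y, hy⟩ := hx k
    exact ⟨(y : H1 (tateRep W p) ⊤), by rw [← Submodule.coe_smul, hy]⟩
  -- (4) Nakayama
  haveI : Module.Finite ℤ_[p] J :=
    IntegralH1Finite.module_finite_of_addMonoidHom r (h1Unramified (geomTorsion W (p : ℤ)) S') hr hker hsep
  exact ⟨J, hle, this, hdiv⟩


/-- **The `p`-saturated hull of `H¹(ℤ[1/p], T_pW)` in `H¹(Γ_ℚ, T_pW)`**: there is a `ℤ_p`-submodule `N` with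
`integralH1 ≤ N`, `N` finitely generated, `p • z ∈ N ⇒ z ∈ N`, every element of `N` having a `p`-power
multiple in `integralH1`, and ONE exponent `b` with `p^b • N ⊆ integralH1`.  (`N` = the classes with a
`p`-power multiple in `integralH1`; `N ≤ J` of the previous theorem, so `N` is finitely generated over the
Noetherian `ℤ_p`, and finitely many generators give the uniform `b`.)
[cite: Kato2004Asterisque, §8.2 Lemma 8.5 (pp. 180–184) and §13.8 (p. 228)] -/
theorem exists_saturatedHull_integralH1 :
    ∃ N : Submodule ℤ_[p] (H1 (tateRep W p) ⊤), integralH1 (tateRep W p) p ⊤ ≤ N ∧ Module.Finite ℤ_[p] ↥N ∧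
      (∀ z : H1 (tateRep W p) ⊤, (p : ℤ_[p]) • z ∈ N → z ∈ N) ∧
      (∀ z ∈ N, ∃ n : ℕ, ((p : ℤ_[p]) ^ n) • z ∈ integralH1 (tateRep W p) p ⊤) ∧
      ∃ b : ℕ, ∀ z ∈ N, ((p : ℤ_[p]) ^ b) • z ∈ integralH1 (tateRep W p) p ⊤ := by
  classical
  obtain ⟨J, hAJ, hJfin, hJdiv⟩ := exists_saturated_finite_submodule_ge_integralH1 W p
  set A := integralH1 (tateRep W p) p ⊤ with hA
  -- the hull
  let N : Submodule ℤ_[p] (H1 (tateRep W p) ⊤) :=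
    { carrier := {z | ∃ n : ℕ, ((p : ℤ_[p]) ^ n) • z ∈ A}
      zero_mem' := ⟨0, by rw [smul_zero]; exact A.zero_mem⟩
      add_mem' := by
        rintro x y ⟨m, hm⟩ ⟨n, hn⟩
        refine ⟨m + n, ?_⟩
        rw [smul_add]
        refine A.add_mem ?_ ?_
        · rw [pow_add, mul_comm, mul_smul]; exact A.smul_mem _ hm
        · rw [pow_add, mul_smul]; exact A.smul_mem _ hn
      smul_mem' := by
        rintro c x ⟨n, hn⟩
        exact ⟨n, by rw [smul_comm]; exact A.smul_mem c hn⟩ }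
  have hN : ∀ z, z ∈ N ↔ ∃ n : ℕ, ((p : ℤ_[p]) ^ n) • z ∈ A := fun z ↦ Iff.rfl
  have hAN : A ≤ N := fun z hz ↦ (hN z).mpr ⟨0, by rw [pow_zero, one_smul]; exact hz⟩
  have hsat : ∀ z : H1 (tateRep W p) ⊤, (p : ℤ_[p]) • z ∈ N → z ∈ N := by
    rintro z ⟨n, hn⟩
    exact (hN z).mpr ⟨n + 1, by rw [pow_succ, mul_smul]; exact hn⟩
  -- `N ≤ J`
  have hNJ : N ≤ J := by
    rintro z ⟨n, hn⟩
    induction n generalizing z with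
    | zero => rw [pow_zero, one_smul] at hn; exact hAJ hn
    | succ n ih =>
      apply hJdiv
      apply ih
      rw [pow_succ', mul_smul] at hn
      rwa [smul_comm] at hn
  -- `N` is finitely generated (Noetherian `ℤ_p`)
  haveI := hJfin
  haveI hNfin : Module.Finite ℤ_[p] ↥N :=
    Module.Finite.of_injective (Submodule.inclusion hNJ) (Submodule.inclusion_injective hNJ)
  -- a uniform exponent from a finite generating set
  obtain ⟨s, hs⟩ := Module.Finite.fg_top (R := ℤ_[p]) (M := ↥N)
  have hgen : ∀ g : ↥N, ∃ n : ℕ, ((p : ℤ_[p]) ^ n) • (g : H1 (tateRep W p) ⊤) ∈ A := fun g ↦ (hN _).mp g.2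
  choose ν hν using hgen
  refine ⟨N, hAN, hNfin, hsat, fun z hz ↦ (hN z).mp hz, ∑ g ∈ s, ν g, fun z hz ↦ ?_⟩
  have hmem : (⟨z, hz⟩ : ↥N) ∈ Submodule.span ℤ_[p] (s : Set ↥N) := by rw [hs]; exact Submodule.mem_top
  obtain ⟨f, -, hf⟩ := Submodule.mem_span_finset.mp hmem
  have hz' : z = ∑ a ∈ s, f a • (a : H1 (tateRep W p) ⊤) := by
    have h := congrArg (fun w : ↥N ↦ (w : H1 (tateRep W p) ⊤)) hf
    simp only [Submodule.coe_sum, Submodule.coe_smul] at h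
    exact h.symm
  rw [hz', Finset.smul_sum]
  refine A.sum_mem fun a ha ↦ ?_
  rw [smul_comm]
  refine A.smul_mem (f a) ?_
  -- `p^{Σ ν} • a ∈ A` since `p^{ν a} • a ∈ A` and `ν a ≤ Σ ν`
  obtain ⟨d, hd⟩ : ∃ d, ∑ g ∈ s, ν g = ν a + d := ⟨_, (Nat.add_sub_cancel' (Finset.single_le_sum
    (fun _ _ ↦ Nat.zero_le _) ha)).symm⟩
  rw [hd, pow_add, mul_comm, mul_smul]
  exact A.smul_mem _ (hν a)

end Literature.NumberTheory.EllipticCurves.Kato2004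

end
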